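import Summits.AtomisticToContinuum.HydrodynamicLimit.Theorems.CollisionIsometryCLTCollisionalTransferLocalityRhsSupConst
import Summits.AtomisticToContinuum.HydrodynamicLimit.Theorems.CollisionIsometryCLTCollisionalTransferLocalityCcTimeIntegralConst
import Summits.AtomisticToContinuum.HydrodynamicLimit.Theorems.CollisionIsometryCLTCollisionalTransferLocalityBlockFields
import Summits.AtomisticToContinuum.HydrodynamicLimit.Theorems.CollisionIsometryCLTCollisionalTransferLocalityMesoscopicLLNConst
import Summits.AtomisticToContinuum.HydrodynamicLimit.Theorems.CollisionIsometryCLTCollisionalTransferLocalityCeilingAllTimesRung0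
import Summits.AtomisticToContinuum.HydrodynamicLimit.Theorems.CollisionIsometryCLTCollisionalTransferLocalityCompressibilityContinuous
import Summits.AtomisticToContinuum.HydrodynamicLimit.Theorems.CollisionIsometryCLTCollisionalTransferLocalityRhsDeterministic
import Summits.AtomisticToContinuum.HydrodynamicLimit.Theorems.CollisionIsometryCLTCollisionalTransferLocalityRhsEnvelope
import Summits.AtomisticToContinuum.HydrodynamicLimit.Theorems.CollisionIsometryCLTCollisionalTransferLocalityDivergenceZero
import HarnessLib

/-!
# The Rhs side of the equilibrium rung of the crux `CollisionalTransferLocality` (sup over `τ ≤ t`),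
# from the constant-profile mesoscopic LLN

Helper file (`--supports stmt-AtomisticToContinuum-9518`, line `hemisphere-affine-slaving`, registered
stub `stub_rhsSup_of_constLLN`) for the crux `CollisionalTransferLocality`. This is a re-threading of the
landed theorem `rhs_sup_tendsto_zero_const` (module `…CollisionalTransferLocalityRhsSupConst`): the SAME
conclusion — at GLOBAL EQUILIBRIUM (the flow-invariant homogeneous local Gibbs law `G_N` of activity `1`,
velocity `0`, temperature `θ`) the right-hand side `Rhs(τ) = ∫₀^τ∫ₓ (div ψ + ∇χ·ū) p_c(ρ̄, θ̄)` of the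
crux tends to `0` in probability UNIFORMLY in `τ ≤ t` — but the hypothesis is now the CONSTANT-PROFILE
mesoscopic law of large numbers itself (the conclusion type of `mesoscopicLLN_const`: `G_N` are probability
measures and `G_N {δ < ∫ₓ (ρ̄ − 1)² + |m̄|² + (Ē − 3θ/2)²} → 0` for every admissible kernel family),
instead of the route item `MesoscopicLLN`. The proof is that of `rhs_sup_tendsto_zero_const` verbatim, with
the single call `mesoscopicLLN_const hMeso θ hθ` replaced by the hypothesis; all slice-measurability and
envelope helpers (`measurable_integral_eulerIntegrand`, `isClosed_setOf_dilute`,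
`envelope_memLp_and_sq_le`, …) are reused from the landed module by name.
-/

namespace Summit.AtomisticToContinuum.HydrodynamicLimit.Theorems.HemisphereAffineSlaving

open scoped BigOperators Topology Classical ENNReal InnerProductSpace
open Filter Set Function MeasureTheory
open Literature.Analysis.FunctionSpaces Literature.Analysis.FluidPDE

noncomputable section

open Literature.MathematicalPhysics.KineticTheory (T3 V3 localGibbsLaw gaussMeasure hsCompressibility)

/-- **Registered stub `stub_rhsSup_of_constLLN` (Rhs side of the equilibrium rung of the crux
`CollisionalTransferLocality`, stmt-AtomisticToContinuum-9518, line hemisphere-affine-slaving).**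
Given the mesoscopic law of large numbers of the block fields AT THE CONSTANT PROFILES `(1, 0, θ)` with its
limit identified (for every `θ > 0` a radius `σ₀ > 0` below which, through every flow family, the
homogeneous local Gibbs laws are probability measures and `∫ₓ (ρ̄ − 1)² + |m̄|² + (Ē − 3θ/2)² → 0` in
probability for every admissible kernel family), for every temperature `θ > 0` there is `σ₀ > 0` such that
under the homogeneous local Gibbs law (activity `1`, velocity `0`, temperature `θ`) at reduced density
`σ < σ₀`, for every flow family, horizon `t > 0`, admissible kernel family and space–time tests smooth on
`[0, t]`, the right-hand side of the crux `Rhs(τ) = ∫₀^τ∫ₓ (div ψ + ∇χ·ū) p_c(ρ̄, θ̄)` tends to `0` in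
probability UNIFORMLY in `τ ≤ t`: `sup_τ |Rhs(τ)| ≤ ∫₀ᵗ |F(s, Φ_s z)| ds` and the time integral is small
by the time-integral-in-probability lemma — each slice is small on the mesoscopic-LLN event at time `s`
(stationarity of the homogeneous law, `abs_integral_eulerW_pcoll_le_of_lln`, continuity of `Z`,
`∫ div ψ = 0`), dominated in `L²` by a velocity-moment envelope on dilute configurations
(`abs_integral_eulerW_pcoll_le_velAvg`, Gaussian moments), and blocks stay dilute at all times w.h.p.
(`ceilingAllTimes_const`). Same proof as `rhs_sup_tendsto_zero_const`. [folklore] -/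
theorem stub_rhsSup_of_constLLN : (∀ θ : ℝ, 0 < θ → ∃ σ₀ : ℝ, 0 < σ₀ ∧ ∀ σ : ℝ, 0 < σ → σ < σ₀ → ∀ Φ : Flows σ, (∀ N, IsProbabilityMeasure (Literature.MathematicalPhysics.KineticTheory.localGibbsLaw σ (fun _ => 1) (fun _ => 0) (fun _ => θ) N (Φ N))) ∧ ∀ (γ C : ℝ) (φ : ℕ → T3 → ℝ), 0 < γ → γ ≤ 1 / 15 → AdmissibleKernel γ C φ → ∀ δ : ℝ, 0 < δ → Tendsto (fun N : ℕ => Literature.MathematicalPhysics.KineticTheory.localGibbsLaw σ (fun _ => 1) (fun _ => 0) (fun _ => θ) N (Φ N) {z | δ < ∫ x, ((rhoB φ N z x - 1) ^ 2 + ‖mB φ N z x‖ ^ 2 + (EB φ N z x - 3 / 2 * θ) ^ 2)}) atTop (𝓝 0)) → ∀ θ : ℝ, 0 < θ → ∃ σ₀ : ℝ, 0 < σ₀ ∧ ∀ σ : ℝ, 0 < σ → σ < σ₀ → ∀ (Φ : Flows σ) (t : ℝ), 0 < t → ∀ (γ C : ℝ) (φ : ℕ → T3 → ℝ), 0 < γ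 → γ ≤ 1 / 15 → AdmissibleKernel γ C φ → ∀ (ψ : ℝ → T3 → V3) (χ : ℝ → T3 → ℝ), Literature.Analysis.FunctionSpaces.Torus.IsSmoothSpaceTimeOn (Icc 0 t) ψ → Literature.Analysis.FunctionSpaces.Torus.IsSmoothSpaceTimeOn (Icc 0 t) χ → ∀ δ : ℝ, 0 < δ → Tendsto (fun N : ℕ => Literature.MathematicalPhysics.KineticTheory.localGibbsLaw σ (fun _ => 1) (fun _ => 0) (fun _ => θ) N (Φ N) {z | ∃ τ ∈ Icc 0 t, δ < |Rhs σ Φ φ ψ χ N z τ|}) atTop (𝓝 0) := by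
  intro hL θ hθ
  -- constants of the equation of state: linear bound and continuity of `Z` at small density
  obtain ⟨ηZ, hηZ, K, hK, hZK⟩ := stub_hsCompressibility_linear
  obtain ⟨ηc, hηc, hZc⟩ := hsCompressibility_continuousOn
  obtain ⟨η₁, hη₁0, hη₁Z, hη₁c⟩ : ∃ η₁ : ℝ, 0 < η₁ ∧ η₁ ≤ ηZ ∧ η₁ ≤ ηc / 2 :=
    ⟨min ηZ (ηc / 2), lt_min hηZ (half_pos hηc), min_le_left _ _, min_le_right _ _⟩
  -- radii: constant-profile mesoscopic LLN, all-times dilute ceiling, `σ³ ≤ η₁`, `σ ≤ 1/2`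
  obtain ⟨σL, hσL, HL⟩ := hL θ hθ
  obtain ⟨σS, hσS, HS⟩ := ceilingAllTimes_const η₁ hη₁0 θ hθ
  refine ⟨min (min σL σS) (min η₁ (1 / 2)),
    lt_min (lt_min hσL hσS) (lt_min hη₁0 (by norm_num)), ?_⟩
  intro σ hσ hlt Φ t ht γ C φ hγ hγ' hadm ψ χ hψ hχ δ hδ
  have hltL : σ < σL := lt_of_lt_of_le hlt ((min_le_left _ _).trans (min_le_left _ _))
  have hltS : σ < σS := lt_of_lt_of_le hlt ((min_le_left _ _).trans (min_le_right _ _))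
  have hση : σ ≤ η₁ := (lt_of_lt_of_le hlt ((min_le_right _ _).trans (min_le_left _ _))).le
  have hhalf : σ ≤ 1 / 2 := (lt_of_lt_of_le hlt ((min_le_right _ _).trans (min_le_right _ _))).le
  have hσ3 : σ ^ 3 ≤ η₁ := by nlinarith [sq_nonneg σ, hσ.le]
  have hσ3Z : σ ^ 3 ≤ ηZ := hσ3.trans hη₁Z
  have hcontZ : ContinuousAt hsCompressibility (σ ^ 3) :=
    hZc.continuousAt (Icc_mem_nhds (by positivity) (by nlinarith [sq_nonneg σ, hσ.le]))
  obtain ⟨hP, hLLN⟩ := HL σ hσ hltL Φ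
  have hDil := HS σ hσ hltS Φ t ht γ C φ hγ hγ' hadm
  obtain ⟨hsm, hφ0, hφ1, -, -, -⟩ := id hadm
  have hφc : ∀ N, Continuous (φ N) := fun N => (hsm N).continuous
  -- the test fields: a common gradient bound, clamped-in-time weight fields
  have hU : UniqueDiffOn ℝ (Icc 0 t) := uniqueDiffOn_Icc ht
  have hpm : ∀ s, (projIcc 0 t ht.le s : ℝ) ∈ Icc 0 t := fun s => (projIcc 0 t ht.le s).2
  have hpI : ∀ {s}, s ∈ Icc 0 t → (projIcc 0 t ht.le s : ℝ) = s := fun hs => by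
    rw [projIcc_of_mem ht.le hs]
  obtain ⟨C₃, hC₃0, hC₃ψ, hC₃χ⟩ := exists_grad_bound ht hψ hχ
  have hgψs : ∀ a : Fin 3, Torus.IsSmoothSpaceTimeOn (Icc 0 t)
      (fun s => Torus.gradient (fun y => ψ s y a)) := fun a => (hψ.apply a).gradient hU
  have hgχs := hχ.gradient hU
  have hdiv_eq : ∀ {s}, s ∈ Icc 0 t → ∀ y, divPsi ψ s y = ∑ a, gradPsi ψ s y a a :=
    fun hs y => (sum_gradPsi_diag_eq_divergence (hψ.isSmooth_slice hs) y).symm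
  have hdiv_b : ∀ {s}, s ∈ Icc 0 t → ∀ y, |divPsi ψ s y| ≤ 3 * C₃ := fun {s} hs y => by
    rw [hdiv_eq hs]
    calc |∑ a, gradPsi ψ s y a a| ≤ ∑ a, |gradPsi ψ s y a a| := Finset.abs_sum_le_sum_abs _ _
      _ ≤ ∑ _a : Fin 3, C₃ := Finset.sum_le_sum fun a _ => hC₃ψ s hs y a a
      _ = 3 * C₃ := by simp
  have hgχ_b : ∀ {s}, s ∈ Icc 0 t → ∀ y a, |gradChi χ s y a| ≤ 3 * C₃ := fun hs y a =>
    (hC₃χ _ hs y a).trans (by linarith)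
  have hdiv_c : ∀ {s}, s ∈ Icc 0 t → Continuous fun y => divPsi ψ s y := fun {s} hs => by
    have h : Continuous fun y => ∑ a, gradPsi ψ s y a a := by
      refine continuous_finsetSum _ fun a _ => ?_
      have hc := ((hgψs a).isSmooth_slice hs).continuous
      simp only [gradPsi]
      fun_prop
    exact h.congr fun y => (hdiv_eq hs y).symm
  have hdiv_i : ∀ {s}, s ∈ Icc 0 t → ∫ y, divPsi ψ s y = 0 := fun hs => by
    simp_rw [hdiv_eq hs]
    exact integral_sum_gradPsi_diag_eq_zero (hψ.isSmooth_slice hs)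
  obtain ⟨g₁, hg₁⟩ : ∃ g₁ : ℝ × T3 → ℝ, ∀ r, g₁ r = ∑ a, gradPsi ψ (projIcc 0 t ht.le r.1) r.2 a a :=
    ⟨_, fun _ => rfl⟩
  obtain ⟨g₂, hg₂⟩ : ∃ g₂ : ℝ × T3 → V3, ∀ r, g₂ r = gradChi χ (projIcc 0 t ht.le r.1) r.2 :=
    ⟨_, fun _ => rfl⟩
  have hg₁c : Continuous g₁ := by
    rw [show g₁ = _ from funext hg₁]
    refine continuous_finsetSum _ fun a _ => ?_
    have hc := continuous_comp_projIcc ht (hgψs a)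
    simp only [gradPsi]
    fun_prop
  have hg₂c : Continuous g₂ := by
    rw [show g₂ = _ from funext hg₂]
    simpa only [gradChi] using continuous_comp_projIcc ht hgχs
  -- the slice functional `Y` (through the clamped weights) and the dilute set `S`
  obtain ⟨Y, hY⟩ : ∃ Y : (N : ℕ) → ℝ → Cfg N → ℝ, ∀ N s w, Y N s w = ∫ x,
      (g₁ (s, x) + ∑ j, g₂ (s, x) j * uB φ N w x j) *
        pcoll σ (rhoB φ N w x) (thetaB φ N w x) := ⟨_, fun _ _ _ => rfl⟩
  have hYeq : ∀ N s (w : Cfg N), Y N s w = ∫ x, eulerW ψ χ φ N (projIcc 0 t ht.le s) w x *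
      pcoll σ (rhoB φ N w x) (thetaB φ N w x) := fun N s w => by
    rw [hY]
    refine integral_congr_ae (ae_of_all _ fun x => ?_)
    simp only [hg₁, hg₂, eulerW, hdiv_eq (hpm s)]
  have hYm : ∀ N, Measurable (uncurry (Y N)) := fun N => by
    simpa only [hY, Function.uncurry_def] using
      measurable_integral_eulerIntegrand σ (hφc N) hg₁c hg₂c
  set S : (N : ℕ) → Set (Cfg N) := fun N => {w | ∀ x, rhoB φ N w x * σ ^ 3 ≤ η₁} with hS
  have hSm : ∀ N, MeasurableSet (S N) := fun N => (isClosed_setOf_dilute (hφc N) σ η₁).measurableSet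
  -- envelope and deterministic smallness on the slices
  set B : ℝ := 3 * C₃ * K * η₁ with hB
  have hEnv : ∀ N s, ∀ w ∈ S N, |Y N s w| ≤ B * (2 * (((N : ℝ) + 1)⁻¹ * ∑ i : Fin (N + 1),
      ‖(w i).2‖ ^ 2) + ((N : ℝ) + 1)⁻¹ * ∑ i : Fin (N + 1), ‖(w i).2‖ ^ 4) := fun N s w hw => by
    rw [hYeq]
    exact abs_integral_eulerW_pcoll_le_velAvg σ K ηZ η₁ (3 * C₃) hσ hK hη₁0 hη₁Z (by positivity)
      hZK φ N (hφc N) (hφ0 N) (hφ1 N) ψ χ _ (hdiv_b (hpm s)) (hgχ_b (hpm s)) w hw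
  -- the process `X`: the slice functional along a measurable modification of the flow, cut off
  -- outside the dilute set
  choose F hFm hF using fun N => exists_measurable_flow Φ N
  have hgood : ∀ N, ∀ᵐ z ∂(localGibbsLaw σ (fun _ => 1) (fun _ => 0) (fun _ => θ) N (Φ N)),
      z ∈ (Φ N).good := fun N => ae_iff.2 (localGibbsLaw_compl_good' (Φ N))
  have hFae : ∀ N s, ∀ᵐ z ∂(localGibbsLaw σ (fun _ => 1) (fun _ => 0) (fun _ => θ) N (Φ N)),
      F N (s, z) = (Φ N).flow s z := fun N s => (hgood N).mono fun z hz => hF N s z hz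
  have hinv := fun N s => map_flow_localGibbsLaw_const σ 1 θ 0 N (Φ N) s
  obtain ⟨W, hW⟩ : ∃ W : (N : ℕ) → ℝ → Cfg N → ℝ, ∀ N s, W N s = fun w =>
      (S N).indicator (fun _ => (1 : ℝ)) w * Y N s w := ⟨_, fun _ _ => rfl⟩
  have hWm : ∀ N s, Measurable (W N s) := fun N s => by
    rw [hW]
    exact ((measurable_const.indicator (hSm N)).mul (hYm N).of_uncurry_left)
  have hWle : ∀ N s w, |W N s w| ≤ B * (2 * (((N : ℝ) + 1)⁻¹ * ∑ i : Fin (N + 1),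
      ‖(w i).2‖ ^ 2) + ((N : ℝ) + 1)⁻¹ * ∑ i : Fin (N + 1), ‖(w i).2‖ ^ 4) := fun N s w => by
    rw [hW]
    by_cases hw : w ∈ S N
    · simp only [Set.indicator_of_mem hw, one_mul]
      exact hEnv N s w hw
    · simp only [Set.indicator_of_notMem hw, zero_mul, abs_zero]
      have hB0 : 0 ≤ B := by positivity
      positivity
  obtain ⟨X, hX⟩ : ∃ X : (N : ℕ) → ℝ → Cfg N → ℝ, ∀ N s, X N s = fun z => |W N s (F N (s, z))| :=
    ⟨_, fun _ _ => rfl⟩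
  -- (i) joint measurability
  have hXm : ∀ N, Measurable (uncurry (X N)) := by
    intro N
    have h1 : Measurable fun q : ℝ × Cfg N => W N q.1 (F N q) := by
      have hWu : Measurable fun q : ℝ × Cfg N => W N q.1 q.2 := by
        have : (fun q : ℝ × Cfg N => W N q.1 q.2) = fun q =>
            (S N).indicator (fun _ => (1 : ℝ)) q.2 * Y N q.1 q.2 := by
          funext q; rw [hW]
        rw [this]
        exact ((measurable_const.indicator (hSm N)).comp measurable_snd).mul (hYm N)
      exact hWu.comp (measurable_fst.prodMk (hFm N))
    simpa only [hX, Function.uncurry_def] using h1.abs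
  -- (ii) square integrability and (iii) uniform second moments, by stationarity and the envelope
  have hEnv2 := fun N => envelope_memLp_and_sq_le hθ hhalf Φ N B
  have hWL2 : ∀ N s, MemLp (W N s) 2 (localGibbsLaw σ (fun _ => 1) (fun _ => 0) (fun _ => θ) N (Φ N)) :=
    fun N s => MemLp.of_le (hEnv2 N).1 (hWm N s).aestronglyMeasurable
      (ae_of_all _ fun w => by
        rw [Real.norm_eq_abs, Real.norm_eq_abs]
        exact (hWle N s w).trans (le_abs_self _))
  have hXL2 : ∀ N, ∀ s ∈ Icc 0 t, MemLp (X N s) 2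
      (localGibbsLaw σ (fun _ => 1) (fun _ => 0) (fun _ => θ) N (Φ N)) := fun N s _ => by
    rw [hX]
    exact (memLp_comp_of_map_eq ((Φ N).measurable_flow s) (hinv N s) (hFae N s) (hWL2 N s)).abs
  have hXC : ∀ N, ∀ s ∈ Icc 0 t, ∫ z, X N s z ^ 2
      ∂(localGibbsLaw σ (fun _ => 1) (fun _ => 0) (fun _ => θ) N (Φ N)) ≤
      2 * B ^ 2 * (4 * ∫ v, (‖v‖ ^ 2) ^ 2 ∂(gaussMeasure (0 : V3) θ) +
        ∫ v, (‖v‖ ^ 4) ^ 2 ∂(gaussMeasure (0 : V3) θ)) := fun N s _ => by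
    simp only [hX, sq_abs]
    rw [integral_sq_comp_eq ((Φ N).measurable_flow s) (hinv N s) (hFae N s) (hWm N s)]
    refine le_trans ?_ (hEnv2 N).2
    refine integral_mono_of_nonneg (ae_of_all _ fun w => sq_nonneg _) (hEnv2 N).1.integrable_sq
      (ae_of_all _ fun w => ?_)
    have h := hWle N s w
    exact sq_le_sq' (abs_le.1 h).1 (abs_le.1 h).2
  -- (iv) convergence in probability of each slice `s ∈ [0, t]`
  have hXlim : ∀ s ∈ Icc 0 t, ∀ η : ℝ, 0 < η → Tendsto (fun N : ℕ =>
      localGibbsLaw σ (fun _ => 1) (fun _ => 0) (fun _ => θ) N (Φ N) {z | η < |X N s z|})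
      atTop (𝓝 0) := by
    intro s hs η hη
    obtain ⟨ε', hε', Hε⟩ := abs_integral_eulerW_pcoll_le_of_lln θ σ K ηZ η₁ (3 * C₃) hθ hσ hK hη₁0
      hη₁Z hσ3Z (by positivity) hZK hcontZ (η / 2) (half_pos hη)
    have hstat := hLLN γ C φ hγ hγ' hadm ε' hε'
    refine tendsto_of_tendsto_of_tendsto_of_le_of_le tendsto_const_nhds hstat
      (fun N => zero_le) fun N => ?_
    have hsub : {w : Cfg N | η < |W N s w|} ⊆ {z | ε' < ∫ x, ((rhoB φ N z x - 1) ^ 2 +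
        ‖mB φ N z x‖ ^ 2 + (EB φ N z x - 3 / 2 * θ) ^ 2)} := by
      intro w hw
      simp only [mem_setOf_eq] at hw ⊢
      by_contra hle
      push Not at hle
      rw [hW] at hw
      by_cases hwS : w ∈ S N
      · simp only [Set.indicator_of_mem hwS, one_mul] at hw
        have h := Hε φ N (hφc N) (hφ0 N) ψ χ s (hdiv_c hs) (hdiv_b hs) (hgχ_b hs) (hdiv_i hs) w
          hwS hle
        rw [hYeq, hpI hs] at hw
        linarith
      · simp only [Set.indicator_of_notMem hwS, zero_mul, abs_zero] at hw
        linarith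
    calc localGibbsLaw σ (fun _ => 1) (fun _ => 0) (fun _ => θ) N (Φ N) {z | η < |X N s z|}
        = localGibbsLaw σ (fun _ => 1) (fun _ => 0) (fun _ => θ) N (Φ N)
            {z | η < |W N s (F N (s, z))|} := by simp only [hX, abs_abs]
      _ ≤ localGibbsLaw σ (fun _ => 1) (fun _ => 0) (fun _ => θ) N (Φ N) {w | η < |W N s w|} :=
          measure_event_comp_le ((Φ N).measurable_flow s) (hinv N s) (hFae N s) (W N s) η
      _ ≤ _ := measure_mono hsub
  -- the time-integral lemma on `[0, t]`
  have hmain := tendsto_measure_setIntegral_of_forall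
    (fun N => localGibbsLaw σ (fun _ => 1) (fun _ => 0) (fun _ => θ) N (Φ N)) hP ht.le X hXm hXL2
    hXC hXlim δ hδ
  -- conclusion: `sup_τ |Rhs τ| ≤ ∫₀ᵗ X ds` on good, all-times-dilute data with integrable paths
  refine tendsto_of_tendsto_of_tendsto_of_le_of_le tendsto_const_nhds
    (by simpa using hmain.add hDil) (fun N => zero_le) fun N => ?_
  haveI := hP N
  refine (measure_mono_ae ?_).trans (measure_union_le _ _)
  filter_upwards [hgood N, ae_integrableOn_Icc_of_sq_le _ (hXm N) (hXL2 N) (hXC N)] with z hz hzi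
  intro hzE
  obtain ⟨τ, hτ, hτδ⟩ := hzE
  by_cases hBd : ∃ s ∈ Icc 0 t, ∃ x : T3, η₁ < rhoB φ N ((Φ N).flow s z) x * σ ^ 3
  · exact Or.inr hBd
  refine Or.inl ?_
  push Not at hBd
  show δ < |∫ s in Icc 0 t, X N s z|
  by_contra hA
  push Not at hA
  -- on `[0, τ]` the integrand of `Rhs` has absolute value `X`
  have hXnn : ∀ s, 0 ≤ X N s z := fun s => by rw [hX]; exact abs_nonneg _
  have hslice : ∀ s ∈ Icc 0 τ, |∫ x, eulerW ψ χ φ N s ((Φ N).flow s z) x *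
      pcoll σ (rhoB φ N ((Φ N).flow s z) x) (thetaB φ N ((Φ N).flow s z) x)| = X N s z := by
    intro s hs
    have hs' : s ∈ Icc 0 t := ⟨hs.1, hs.2.trans hτ.2⟩
    have hdilS : (Φ N).flow s z ∈ S N := fun x => hBd s hs' x
    simp only [hX, hW, hF N s z hz, Set.indicator_of_mem hdilS, one_mul]
    rw [hYeq, hpI hs']
  have h1 : |Rhs σ Φ φ ψ χ N z τ| ≤ ∫ s in Icc 0 τ, X N s z := by
    unfold Rhs
    rw [← Real.norm_eq_abs]
    refine (norm_integral_le_integral_norm _).trans (le_of_eq ?_)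
    refine setIntegral_congr_fun measurableSet_Icc fun s hs => ?_
    rw [Real.norm_eq_abs]
    exact hslice s hs
  have h2 : ∫ s in Icc 0 τ, X N s z ≤ ∫ s in Icc 0 t, X N s z :=
    setIntegral_mono_set hzi (ae_of_all _ fun s => hXnn s)
      (Icc_subset_Icc_right hτ.2).eventuallyLE
  have h3 : ∫ s in Icc 0 t, X N s z ≤ δ := (le_abs_self _).trans hA
  linarith
end

end Summit.AtomisticToContinuum.HydrodynamicLimit.Theorems.HemisphereAffineSlaving
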